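import Literature.NumberTheory.Automorphic.TwistedQuotientRestrictScalars
import Mathlib.RepresentationTheory.Subrepresentation
import Mathlib.RepresentationTheory.Intertwining
import HarnessLib

/-!
# Restriction of scalars along a surjection `R ↠ k`: subrepresentations and group-ring-linear maps

Topic `RepresentationTheory`; namespace `Literature.RepresentationTheory`.  Plumbing DEFINITIONS + API (reviewed
kind); no named fact, no instance, no notation, no `sorry`.  Restriction of scalars of a representation is the
tree's `Literature.NumberTheory.Automorphic.TwistedQuotient.resScalars R ρ` (universe-monomorphic: all types in
one universe `u`), reused here.

Setting of the reduction of stable lattices [SerreLinearRepresentations1977, §15.1–15.2: a lattice `E₁` of the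
`K`-space `E`, its reduction `Ē₁ = E₁/𝔪E₁`, a `k[G]`-module]; [EmertonGeeSavitt2015, §4.1]: the reduction
`L/ϖL` of a `G`-stable `R`-lattice is naturally a module over the group ring `R[G]` on which `R` acts through
`k = R/ϖ`, while the representation theory one wants to quote is that of the `k`-REPRESENTATION `L/ϖL`.  When
`R → k` is onto the two points of view agree; this file records the dictionary:

* `smul_mem_of_surjective` — an `R`-submodule of a `k`-module is a `k`-submodule;
* **`subrepResScalarsOrderIso ρ hsurj : Subrepresentation (ρ|_R) ≃o Subrepresentation ρ`** (same carriers) with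
  membership lemmas, and `mem_asSubmodule_symm_iff` (through Mathlib's
  `Subrepresentation.subrepresentationSubmoduleOrderIso : Subrepresentation (ρ|_R) ≃o Submodule R[G] (ρ|_R).asModule`);
* **`intertwiningMapOfLinearMap`** — an `R[G]`-linear map from (the `R[G]`-submodule attached to) a
  `k`-subrepresentation `X ⊆ ρ` to `(σ|_R).asModule` IS a `k`-linear `G`-equivariant map `X → σ`
  (`_apply`, `_injective`);
* `Representation.IntertwiningMap.resScalarsMap R f : ρ|_R → σ|_R` — an intertwining map of
  `k`-representations restricted to `R`.
-/

noncomputable section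

namespace Literature.RepresentationTheory

open Function
open Literature.NumberTheory.Automorphic (TwistedQuotient.resScalars TwistedQuotient.resScalars_apply)

universe u

variable {R k : Type u} [CommRing R] [CommRing k] [Algebra R k] {G : Type u} [Group G]
  {V : Type u} [AddCommGroup V] [Module k V] [Module R V] [IsScalarTower R k V]
  (ρ : Representation k G V)

/-- A `k`-submodule which is an `R`-submodule: when `R → k` is onto, every `R`-submodule of a `k`-module
closed under the `R`-action is closed under the `k`-action. [cite: SerreLinearRepresentations1977, §15.2] -/
theorem smul_mem_of_surjective (hsurj : Surjective (algebraMap R k)) {N : Submodule R V} (c : k) {v : V}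
    (hv : v ∈ N) : c • v ∈ N := by
  obtain ⟨r, rfl⟩ := hsurj c
  rw [algebraMap_smul]
  exact N.smul_mem r hv

/-- **Subrepresentations do not see the restriction of scalars along a surjection**: for `R → k` onto, the
`R`-subrepresentations of `ρ|_R` are exactly the `k`-subrepresentations of `ρ` (same carriers). [cite: SerreLinearRepresentations1977, §15.2] -/
def subrepResScalarsOrderIso (hsurj : Surjective (algebraMap R k)) :
    Subrepresentation (TwistedQuotient.resScalars R ρ) ≃o Subrepresentation ρ where
  toFun N :=
    ⟨{ carrier := N.toSubmodule
       add_mem' := fun ha hb => N.toSubmodule.add_mem ha hb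
       zero_mem' := N.toSubmodule.zero_mem
       smul_mem' := fun c _ hv => smul_mem_of_surjective hsurj c hv },
      fun g _ hv => N.apply_mem_toSubmodule g hv⟩
  invFun N' := ⟨N'.toSubmodule.restrictScalars R, fun g _ hv => N'.apply_mem_toSubmodule g hv⟩
  left_inv N := by ext v; rfl
  right_inv N' := by ext v; rfl
  map_rel_iff' := Iff.rfl

/-- Unfolding / transport lemma `mem_subrepResScalarsOrderIso_iff`. [cite: SerreLinearRepresentations1977, §15.2] -/
@[simp]
theorem mem_subrepResScalarsOrderIso_iff (hsurj : Surjective (algebraMap R k))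
    (N : Subrepresentation (TwistedQuotient.resScalars R ρ)) (v : V) :
    v ∈ subrepResScalarsOrderIso ρ hsurj N ↔ v ∈ N := Iff.rfl

/-- Unfolding / transport lemma `mem_subrepResScalarsOrderIso_symm_iff`. [cite: SerreLinearRepresentations1977, §15.2] -/
@[simp]
theorem mem_subrepResScalarsOrderIso_symm_iff (hsurj : Surjective (algebraMap R k))
    (N' : Subrepresentation ρ) (v : V) :
    v ∈ (subrepResScalarsOrderIso ρ hsurj).symm N' ↔ v ∈ N' := Iff.rfl

/-- Carriers: `(Φ N : Set V) = N`. [cite: SerreLinearRepresentations1977, §15.2] -/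
theorem coe_subrepResScalarsOrderIso (hsurj : Surjective (algebraMap R k))
    (N : Subrepresentation (TwistedQuotient.resScalars R ρ)) :
    ((subrepResScalarsOrderIso ρ hsurj N : Subrepresentation ρ) : Set V) = (N : Set V) := rfl

variable {W : Type u} [AddCommGroup W] [Module k W] [Module R W] [IsScalarTower R k W]
  (σ : Representation k G W)

/-- Membership in the `R[G]`-submodule attached to a `k`-subrepresentation (through the two order
isomorphisms `Subrepresentation ρ ≃o Subrepresentation ρ|_R ≃o Submodule R[G] (ρ|_R).asModule`). [cite: SerreLinearRepresentations1977, §15.2] -/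
theorem mem_asSubmodule_symm_iff (hsurj : Surjective (algebraMap R k)) (X : Subrepresentation ρ) (v : V) :
    v ∈ Subrepresentation.asSubmodule ((subrepResScalarsOrderIso ρ hsurj).symm X) ↔ v ∈ X := Iff.rfl

/-- **From group-ring linearity over `R` to an intertwining map over `k`.**  Let `X` be a subrepresentation
of the `k`-representation `ρ`, `S = X` viewed as an `R[G]`-submodule of `(ρ|_R).asModule`, and
`h : S → (σ|_R).asModule` an `R[G]`-linear map.  When `R → k` is onto, `h` is `k`-linear and `G`-equivariant:
an intertwining map `X → σ`. [cite: SerreLinearRepresentations1977, §15.2] -/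
def intertwiningMapOfLinearMap (hsurj : Surjective (algebraMap R k)) (X : Subrepresentation ρ)
    (h : ↥(Subrepresentation.asSubmodule ((subrepResScalarsOrderIso ρ hsurj).symm X)) →ₗ[MonoidAlgebra R G]
      (TwistedQuotient.resScalars R σ).asModule) :
    X.toRepresentation.IntertwiningMap σ where
  toFun x := (TwistedQuotient.resScalars R σ).asModuleEquiv
    (h ⟨(TwistedQuotient.resScalars R ρ).asModuleEquiv.symm (x : V), x.2⟩)
  map_add' x y := by
    rw [← map_add, ← map_add]
    rfl
  map_smul' c x := by
    obtain ⟨r, rfl⟩ := hsurj c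
    rw [RingHom.id_apply, algebraMap_smul, algebraMap_smul, ← LinearEquiv.map_smul,
      ← LinearMap.map_smul_of_tower]
    rfl
  isIntertwining' g := by
    refine LinearMap.ext fun x => ?_
    change (TwistedQuotient.resScalars R σ).asModuleEquiv
        (h ⟨(TwistedQuotient.resScalars R ρ).asModuleEquiv.symm ((ρ g) (x : V)), _⟩) =
      σ g ((TwistedQuotient.resScalars R σ).asModuleEquiv
        (h ⟨(TwistedQuotient.resScalars R ρ).asModuleEquiv.symm (x : V), x.2⟩))
    have key : (⟨(TwistedQuotient.resScalars R ρ).asModuleEquiv.symm ((ρ g) (x : V)),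
        X.apply_mem_toSubmodule g x.2⟩ :
          ↥(Subrepresentation.asSubmodule ((subrepResScalarsOrderIso ρ hsurj).symm X))) =
        MonoidAlgebra.single g (1 : R) •
          (⟨(TwistedQuotient.resScalars R ρ).asModuleEquiv.symm (x : V), x.2⟩ :
            ↥(Subrepresentation.asSubmodule ((subrepResScalarsOrderIso ρ hsurj).symm X))) := by
      refine Subtype.ext ?_
      rw [Submodule.coe_smul, Representation.single_smul, one_smul]
      rfl
    rw [key, map_smul, Representation.single_smul, one_smul]
    rfl

/-- The underlying function of `intertwiningMapOfLinearMap` is `h`. [cite: SerreLinearRepresentations1977, §15.2] -/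
theorem intertwiningMapOfLinearMap_apply (hsurj : Surjective (algebraMap R k)) (X : Subrepresentation ρ)
    (h : ↥(Subrepresentation.asSubmodule ((subrepResScalarsOrderIso ρ hsurj).symm X)) →ₗ[MonoidAlgebra R G]
      (TwistedQuotient.resScalars R σ).asModule) (x : X.toSubmodule) :
    intertwiningMapOfLinearMap ρ σ hsurj X h x =
      (TwistedQuotient.resScalars R σ).asModuleEquiv
        (h ⟨(TwistedQuotient.resScalars R ρ).asModuleEquiv.symm (x : V), x.2⟩) := rfl

/-- `intertwiningMapOfLinearMap h` is injective iff `h` is. [cite: SerreLinearRepresentations1977, §15.2] -/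
theorem intertwiningMapOfLinearMap_injective (hsurj : Surjective (algebraMap R k)) (X : Subrepresentation ρ)
    (h : ↥(Subrepresentation.asSubmodule ((subrepResScalarsOrderIso ρ hsurj).symm X)) →ₗ[MonoidAlgebra R G]
      (TwistedQuotient.resScalars R σ).asModule) (hinj : Injective h) :
    Injective (intertwiningMapOfLinearMap ρ σ hsurj X h) := by
  intro x y hxy
  rw [intertwiningMapOfLinearMap_apply, intertwiningMapOfLinearMap_apply] at hxy
  have := hinj ((TwistedQuotient.resScalars R σ).asModuleEquiv.injective hxy)
  exact Subtype.ext (congrArg (fun z => ((z : ↥(Subrepresentation.asSubmodule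
    ((subrepResScalarsOrderIso ρ hsurj).symm X))) : (TwistedQuotient.resScalars R ρ).asModule)) this)

section ResScalarsMap

variable {W' : Type u} [AddCommGroup W'] [Module k W'] [Module R W'] [IsScalarTower R k W']
  {σ' : Representation k G W'} {ρ}

variable (R) in
/-- An intertwining map of `k`-representations is an intertwining map of their restrictions of scalars. [cite: SerreLinearRepresentations1977, §15.2] -/
def _root_.Representation.IntertwiningMap.resScalarsMap (f : ρ.IntertwiningMap σ') :
    (TwistedQuotient.resScalars R ρ).IntertwiningMap (TwistedQuotient.resScalars R σ') where
  toLinearMap := f.toLinearMap.restrictScalars R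
  isIntertwining' g := by
    refine LinearMap.ext fun v => ?_
    exact LinearMap.congr_fun (f.isIntertwining' g) v

/-- Unfolding / transport lemma `resScalarsMap_apply`. [cite: SerreLinearRepresentations1977, §15.2] -/
@[simp]
theorem _root_.Representation.IntertwiningMap.resScalarsMap_apply (f : ρ.IntertwiningMap σ') (v : V) :
    f.resScalarsMap R v = f v := rfl

end ResScalarsMap

end Literature.RepresentationTheory
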